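import Literature.NumberTheory.EllipticCurves.Hsieh2012.NonvanishingHeckeLValuesModPProofs
import Literature.NumberTheory.EllipticCurves.HeWei2025.PStabilityHeckeLValues
import Literature.NumberTheory.EllipticCurves.KatzPAdicLFunctionCMFieldContinuationProofs
import Literature.NumberTheory.EllipticCurves.KatzPAdicLFunctionCMFieldKatzTypeBaseChangeProofs
import Literature.NumberTheory.EllipticCurves.RohrlichAnticyclotomicTwistsCMForms
import Literature.NumberTheory.GaloisRepresentations.HeckeCharacterArchGammaProofs
import HarnessLib

/-!
# Hsieh 2012 (Amer. J. Math. 134), §6 — the continuation binder of (NV) and the necessity of (R)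

Proof file (theorems only, no new definition, no named fact, no `sorry`; companion of the statement
file `NonvanishingHeckeLValuesModP.lean` and of `NonvanishingHeckeLValuesModPProofs.lean`).

1. **The binder `hL` of (NV) is automatic.** The typed (NV) (`Hsieh2012.NV`, and He's
   `HeWei2025.NVInfinite`) reads the value `L(0, χν)` through an entire continuation
   `hL : LFunction.HasEntireContinuation (heckeLFunction (χν))` supplied by the reader ("`∀ hL`" on
   the good set, "`∃ hL`" on the bad set). Under the standing hypotheses of every §6 fact — `K` CM,
   `Σ_p` a `p`-adic CM type, `χ` of Katz type `kΣ + κ(1 − c)` with `k ≥ 1`, `ν ∈ X⁻_𝔩` of finite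
   order — such an `hL` EXISTS (`hasEntireContinuation_heckeLFunction_mul_of_mem`: a finite-order
   `ν` has Katz type `0`, so `χν` has the Katz type of `χ`, and the tree's
   `KatzCM.hasEntireContinuation_of_hasKatzType_of_isPAdicCMType` = Tate's theorem read through the
   infinity type applies), and its value is proof-irrelevant and equal to that of ANY entire
   function agreeing with the Euler product on `re s > 1` (`continuation_eq_of_differentiable`,
   identity theorem). So the two polarities of the typed (NV) differ from print only in name.
2. **(R) is necessary** (p. 2: "the assumptions (L) and (R) are necessary for the (NV) property.
   The assumption (R) is due to the functional equation of the complex `L`-function `L(s, χ)`";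
   Remark 6.9 (3): "in the self-dual case … if `W(χ*) = −1`, then `a_β(E^h_χ, 𝔠) = 0` for all
   `β`"; He, Math. Ann. 392 (2025) Remark 1.3: "`μ_p(𝒳⁻) = +∞`"). KERNEL-CHECKED from the typed
   predicate `IsSelfDualRootNumber κ χ W`: the completed `Λ` is entire, so `L(s, χ)` has an entire
   continuation (`IsSelfDualRootNumber.hasEntireContinuation`); if `W = −1` then
   `Λ(½) = −Λ(½) = 0`, and by the identity theorem on `re s > 0` the continuation value `L(0, χ)`
   vanishes (`IsSelfDualRootNumber.continuation_zero_eq_zero`: `Λ(½) = B^{1/2} ∏_w Γ_ℂ(κ_w + 1) L(0, χ)`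
   with non-zero constants). Hence every normalised value `L^{alg,𝔩}(0, χν; Ω)` is `0` when
   `W((χν)*) = −1`, and if this holds along the whole family (for `𝔩` split the root number is
   constant on `χ·X⁻_𝔩`, Lemma 6.6 (2) / He Rem. 1.3 — taken as a hypothesis, not proved here) then
   (NV) FAILS (`not_NV_of_forall_isSelfDualRootNumber_neg_one`, granted `X⁻_𝔩` infinite) and so does
   He's `NVInfinite` (`not_NVInfinite_of_forall_isSelfDualRootNumber_neg_one`, unconditionally).
   This is also a sanity certificate for the typed (R): the predicate pins a sign with consequences.
BSD is not touched; item 21341 is not closed by this.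

References: [Hsieh2012] M.-L. Hsieh, Amer. J. Math. 134 (2012) = arXiv:1208.4751, p. 1 ((NV)),
p. 2 (necessity of (L), (R)), Lemma 6.6, Thm. 6.8, Rem. 6.9 (3); [HeWei2025MathAnn] W. He, Math.
Ann. 392 (2025), Rem. 1.3; [TateThesis1967] Thm. 4.4.1 (continuation); [NeukirchANT1999] VII §8.
-/

noncomputable section

open scoped Classical
open scoped Topology
open NumberField IsDedekindDomain Complex Filter
open Literature.NumberTheory.GaloisRepresentations

namespace Literature.NumberTheory.EllipticCurves.Hsieh2012

/-! ### §8. The continuation binder `hL` is automatic on `χ · X⁻_𝔩` -/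

section Continuation

variable {K : Type} [Field K] [NumberField K] {p : ℕ} [Fact p.Prime]

/-- A finite-order Hecke character has Katz type `0·Σ + 0·(1 − c)` (trivial infinity type) for any
`p`-adic datum `(ι, Σ_p)` — the tree's `hasInfinityType_zero_of_isFiniteOrder` in Katz currency.
[cite: NeukirchANT1999, Ch. VII (6.9) (characters of finite order have trivial infinity type)] -/
theorem hasKatzType_zero_of_isFiniteOrder (ι : PadicAlgCl p ≃+* ℂ)
    (Sp : Finset (HeightOneSpectrum (𝓞 K))) {ν : HeckeCharacter K} (hν : ν.IsFiniteOrder) :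
    KatzCM.HasKatzType ι Sp ν 0 0 := by
  have h0 : KatzCM.katzExponent ι Sp 0 (0 : InfinitePlace K → ℕ) = 0 := by
    funext φ
    simp [KatzCM.katzExponent]
  unfold KatzCM.HasKatzType
  rw [h0]
  have h1 : (HeckeCharacter.typeOfExponent (0 : (K →+* ℂ) → ℤ)).1 = fun _ ↦ 0 := by
    funext w; simp [HeckeCharacter.typeOfExponent]
  have h2 : (HeckeCharacter.typeOfExponent (0 : (K →+* ℂ) → ℤ)).2 = fun _ ↦ 0 := by
    funext w; simp [HeckeCharacter.typeOfExponent]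
  rw [h1, h2]
  exact hasInfinityType_zero_of_isFiniteOrder hν

/-- Twisting by a finite-order character does not change the Katz type: `χ` of type `kΣ + κ(1 − c)`
and `ν` of finite order give `χν` of type `kΣ + κ(1 − c)` (`KatzCM.HasKatzType.mul` with `δ = 0`)
— the characters `χν`, `ν ∈ X⁻_𝔩`, of (NV). [cite: Hsieh2012, p. 1 (the family `χν`, `ν ∈ X⁻_𝔩`)] -/
theorem hasKatzType_mul_of_isFiniteOrder {ι : PadicAlgCl p ≃+* ℂ}
    {Sp : Finset (HeightOneSpectrum (𝓞 K))} {χ ν : HeckeCharacter K} {k : ℕ}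
    {κ : InfinitePlace K → ℕ} (hχ : KatzCM.HasKatzType ι Sp χ k κ) (hν : ν.IsFiniteOrder) :
    KatzCM.HasKatzType ι Sp (χ * ν) k κ := by
  have h := hχ.mul (hasKatzType_zero_of_isFiniteOrder ι Sp hν)
  rwa [add_zero] at h

/-- **The continuation binder of (NV) is automatic**: on a CM field with a `p`-adic CM type, for
`χ` of Katz type `kΣ + κ(1 − c)` with `k ≥ 1` and `ν` of finite order, `L(s, χν)` has an entire
continuation (Tate's theorem through the infinity type: the tree's
`KatzCM.hasEntireContinuation_of_hasKatzType_of_isPAdicCMType`). So the binder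
`hL : LFunction.HasEntireContinuation (heckeLFunction (χν))` of `Hsieh2012.NV` / `HeWei2025.NVInfinite`
is inhabited at every point of the family under the hypotheses of the §6 facts.
[cite: Hsieh2012, p. 1 (`L^{alg,𝔩}(0, χν)` for `ν ∈ X⁻_𝔩`)] [cite: TateThesis1967, Thm. 4.4.1] -/
theorem hasEntireContinuation_heckeLFunction_mul_of_isFiniteOrder [IsCMField K]
    {ι : PadicAlgCl p ≃+* ℂ} {Sp : Finset (HeightOneSpectrum (𝓞 K))}
    (hSp : KatzCM.IsPAdicCMType p Sp) {χ ν : HeckeCharacter K} {k : ℕ} {κ : InfinitePlace K → ℕ}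
    (hχ : KatzCM.HasKatzType ι Sp χ k κ) (hk : 1 ≤ k) (hν : ν.IsFiniteOrder) :
    LFunction.HasEntireContinuation (heckeLFunction (χ * ν)) :=
  KatzCM.hasEntireContinuation_of_hasKatzType_of_isPAdicCMType hSp
    (hasKatzType_mul_of_isFiniteOrder hχ hν) hk

/-- The same for `ν ∈ X⁻_𝔩` (`Hsieh2012.lPowerAnticyclotomicFamily ℓ 𝔏`, `ℓ ≥ 1`): every member has
finite order. [cite: Hsieh2012, p. 1 ((NV): the values `L^{alg,𝔩}(0, χν)`, `ν ∈ X⁻_𝔩`)] -/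
theorem hasEntireContinuation_heckeLFunction_mul_of_mem [IsCMField K]
    {ι : PadicAlgCl p ≃+* ℂ} {Sp : Finset (HeightOneSpectrum (𝓞 K))}
    (hSp : KatzCM.IsPAdicCMType p Sp) {χ : HeckeCharacter K} {k : ℕ} {κ : InfinitePlace K → ℕ}
    (hχ : KatzCM.HasKatzType ι Sp χ k κ) (hk : 1 ≤ k) {ℓ : ℕ} (hℓ : 0 < ℓ)
    {𝔏 : HeightOneSpectrum (𝓞 K)} {ν : HeckeCharacter K} (hν : ν ∈ lPowerAnticyclotomicFamily ℓ 𝔏) :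
    LFunction.HasEntireContinuation (heckeLFunction (χ * ν)) :=
  hasEntireContinuation_heckeLFunction_mul_of_isFiniteOrder hSp hχ hk
    (isFiniteOrder_of_mem_lPowerAnticyclotomicFamily hℓ hν)

omit [NumberField K] in
/-- **Uniqueness of the continuation value** (identity theorem): the chosen entire continuation of
`f` IS any entire `g` that agrees with `f` on `re s > 1`. In particular the value `L(0, χν)` read by
(NV) does not depend on which continuation is supplied. [cite: NeukirchANT1999, Ch. VII §8 (uniqueness of analytic continuation)] -/
theorem continuation_eq_of_differentiable {f g : ℂ → ℂ} (hL : LFunction.HasEntireContinuation f)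
    (hg : Differentiable ℂ g) (hgf : ∀ s : ℂ, 1 < s.re → g s = f s) : hL.continuation = g := by
  have hc : AnalyticOnNhd ℂ hL.continuation Set.univ :=
    hL.differentiable_continuation.differentiableOn.analyticOnNhd isOpen_univ
  have hg' : AnalyticOnNhd ℂ g Set.univ := hg.differentiableOn.analyticOnNhd isOpen_univ
  refine hc.eq_of_eventuallyEq hg' (z₀ := 2) ?_
  have hopen : IsOpen {s : ℂ | 1 < s.re} := isOpen_lt continuous_const Complex.continuous_re
  have hmem : (2 : ℂ) ∈ {s : ℂ | 1 < s.re} := by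
    show (1 : ℝ) < (2 : ℂ).re
    norm_num
  filter_upwards [hopen.mem_nhds hmem] with s hs
  rw [hL.continuation_eq hs, hgf s hs]

omit [NumberField K] in
/-- The continuation value is proof-irrelevant: two proofs of `HasEntireContinuation f` choose the
same function (they are the same proof). Recorded so that the "`∀ hL`" / "`∃ hL`" polarities of the
typed (NV) are seen to concern only the EXISTENCE of a continuation. [cite: Hsieh2012, p. 1 ((NV))] -/
theorem continuation_apply_eq {f : ℂ → ℂ} (h h' : LFunction.HasEntireContinuation f) (s : ℂ) :
    h.continuation s = h'.continuation s := rfl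

/-- **"All but finitely many `ν ∈ X⁻_𝔩` are good"** — the cofinite reading of the typed (NV): under
`NV ι ℓ 𝔏 χ k κ` there is a period vector for which the set of `ν ∈ X⁻_𝔩` that FAIL to have all
their continuation values of `p`-adic norm exactly `1` is finite (such a `ν` has a continuation
value of norm `≠ 1`, hence `< 1` by the integrality clause, so it lies in the finite bad set).
[cite: Hsieh2012, p. 1 ((NV): "for almost all ν ∈ X⁻_𝔩 … except for finitely many")] -/
theorem NV.finite_setOf_not_norm_eq_one [IsCMField K] {ι : PadicAlgCl p ≃+* ℂ} {ℓ : ℕ}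
    {𝔏 : HeightOneSpectrum (𝓞 K)} {χ : HeckeCharacter K} {k : ℕ} {κ : InfinitePlace K → ℕ}
    (h : NV ι ℓ 𝔏 χ k κ) :
    ∃ Ω : InfinitePlace K → ℂ, (∀ w, Ω w ≠ 0) ∧
      {ν : HeckeCharacter K | ν ∈ lPowerAnticyclotomicFamily ℓ 𝔏 ∧
        ¬ ∀ hL : LFunction.HasEntireContinuation (heckeLFunction (χ * ν)),
          ‖ι.symm (algebraicLValue k κ Ω 𝔏 (χ * ν) (hL.continuation 0))‖ = 1}.Finite := by
  obtain ⟨Ω, hΩ, hint, hfin⟩ := h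
  refine ⟨Ω, hΩ, hfin.subset ?_⟩
  rintro ν ⟨hν, hbad⟩
  refine ⟨hν, ?_⟩
  by_contra hno
  refine hbad fun hL ↦ le_antisymm (hint ν hν hL) ?_
  by_contra hlt
  exact hno ⟨hL, lt_of_not_ge hlt⟩

end Continuation

/-! ### §9. Necessity of (R): root number `−1` forces `L(0, χ) = 0` -/

section RootNumber

variable {K : Type} [Field K] [NumberField K]

/-- `re (s + n + ½) = re s + n + ½`. [folklore] -/
private theorem re_add_nat_add_half (s : ℂ) (n : ℕ) :
    (s + (n : ℂ) + 1 / 2).re = s.re + n + 1 / 2 := by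
  have h : (1 / 2 : ℂ) = ((1 / 2 : ℝ) : ℂ) := by push_cast; ring
  rw [h, add_re, add_re, ofReal_re, natCast_re]

/-- `re (s + ½) = re s + ½`. [folklore] -/
private theorem re_add_half (s : ℂ) : (s + 1 / 2).re = s.re + 1 / 2 := by
  have h : (1 / 2 : ℂ) = ((1 / 2 : ℝ) : ℂ) := by push_cast; ring
  rw [h, add_re, ofReal_re]

/-- `re (s − ½) = re s − ½`. [folklore] -/
private theorem re_sub_half (s : ℂ) : (s - 1 / 2).re = s.re - 1 / 2 := by
  have h : (1 / 2 : ℂ) = ((1 / 2 : ℝ) : ℂ) := by push_cast; ring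
  rw [h, sub_re, ofReal_re]

/-- **(R)-data give the continuation.** If `W` is a root number of the self-dual character `χ` in
the typed sense (`IsSelfDualRootNumber κ χ W`: an ENTIRE `Λ` with
`Λ(s) = B^s ∏_w Γ_ℂ(s + κ_w + ½) L(s − ½, χ)` on `re s > 1`), then `L(s, χ)` has an entire
continuation, namely `s ↦ Λ(s + ½) B^{−(s+½)} ∏_w Γ_ℂ(s + κ_w + 1)⁻¹` (`1/Γ_ℂ` is entire).
[cite: Hsieh2012, Theorem A (p. 2) hypothesis (R) and §4.1 (p. 10)] [cite: NeukirchANT1999, Ch. VII (8.5)–(8.6)] -/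
theorem IsSelfDualRootNumber.hasEntireContinuation {κ : InfinitePlace K → ℕ} {χ : HeckeCharacter K}
    {W : ℂ} (h : IsSelfDualRootNumber κ χ W) :
    LFunction.HasEntireContinuation (heckeLFunction χ) := by
  obtain ⟨B, hB, Λ, hΛ, hagree, -⟩ := h
  have hB0 : (B : ℂ) ≠ 0 := ofReal_ne_zero.mpr hB.ne'
  refine LFunction.hasEntireContinuation_of_mul_eq (Λ := fun s ↦ Λ (s + 1 / 2))
    (B := fun s ↦ (B : ℂ) ^ (-(s + 1 / 2)) *
      ∏ w : InfinitePlace K, (Gammaℂ (s + 1 / 2 + (κ w : ℂ) + 1 / 2))⁻¹)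
    (hΛ.comp (differentiable_id.add_const _)) ?_ fun s hs ↦ ?_
  · refine (((differentiable_id.add_const _).neg).const_cpow (Or.inl hB0)).mul ?_
    refine Differentiable.fun_finsetProd (𝕜 := ℂ) (𝔸' := ℂ) (u := Finset.univ)
      (f := fun w s ↦ (Gammaℂ (s + 1 / 2 + (κ w : ℂ) + 1 / 2))⁻¹) fun w _ ↦ ?_
    exact differentiable_Gammaℂ_inv.comp
      (((differentiable_id.add_const _).add_const _).add_const _)
  · have hs' : 1 < (s + 1 / 2).re := by rw [re_add_half]; linarith
    have hΓ : ∀ w : InfinitePlace K, Gammaℂ (s + 1 / 2 + (κ w : ℂ) + 1 / 2) ≠ 0 := fun w ↦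
      Complex.Gammaℂ_ne_zero_of_re_pos (by
        rw [re_add_nat_add_half, re_add_half]; positivity)
    have hE : (B : ℂ) ^ (s + 1 / 2) ≠ 0 := fun h ↦ hB0 ((cpow_eq_zero_iff _ _).mp h).1
    have hP : ∏ w : InfinitePlace K, Gammaℂ (s + 1 / 2 + (κ w : ℂ) + 1 / 2) ≠ 0 :=
      Finset.prod_ne_zero_iff.mpr fun w _ ↦ hΓ w
    rw [hagree _ hs', add_sub_cancel_right, Finset.prod_inv_distrib, cpow_neg]
    set E := (B : ℂ) ^ (s + 1 / 2)
    set P := ∏ w : InfinitePlace K, Gammaℂ (s + 1 / 2 + (κ w : ℂ) + 1 / 2)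
    calc E * P * heckeLFunction χ s * (E⁻¹ * P⁻¹)
        = (E * E⁻¹) * (P * P⁻¹) * heckeLFunction χ s := by ring
      _ = heckeLFunction χ s := by rw [mul_inv_cancel₀ hE, mul_inv_cancel₀ hP, one_mul, one_mul]

/-- **Root number `−1` forces `L(0, χ) = 0`** (p. 2: "The assumption (R) is due to the functional
equation of the complex `L`-function `L(s, χ)`"; Rem. 6.9 (3); He 2025 Rem. 1.3). From
`IsSelfDualRootNumber κ χ (−1)`: `Λ(½) = −Λ(1 − ½)` gives `Λ(½) = 0`; the entire `Λ` and
`s ↦ B^s ∏_w Γ_ℂ(s + κ_w + ½) · g(s − ½)`, `g` ANY entire continuation of `L(·, χ)` from `re s > 1`,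
are analytic on the half-plane `re s > 0` and agree on `re s > 3/2`, hence on `re s > 0` (identity
theorem); at `s = ½` this reads `0 = B^{1/2} ∏_w Γ_ℂ(κ_w + 1) · g(0)` with non-zero constants.
[cite: Hsieh2012, p. 2 (necessity of (R): "due to the functional equation") and Remark 6.9 (3) (p. 24)]
[cite: HeWei2025MathAnn, Remark 1.3 (`μ_p(𝒳⁻) = +∞`)] -/
theorem IsSelfDualRootNumber.continuation_zero_eq_zero {κ : InfinitePlace K → ℕ}
    {χ : HeckeCharacter K} (h : IsSelfDualRootNumber κ χ (-1))
    (hL : LFunction.HasEntireContinuation (heckeLFunction χ)) : hL.continuation 0 = 0 := by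
  obtain ⟨B, hB, Λ, hΛ, hagree, hFE⟩ := h
  have hB0 : (B : ℂ) ≠ 0 := ofReal_ne_zero.mpr hB.ne'
  -- Λ(1/2) = 0 from the sign −1
  have hhalf : Λ (1 / 2) = 0 := by
    have h := hFE (1 / 2)
    have h12 : (1 : ℂ) - 1 / 2 = 1 / 2 := by norm_num
    rw [h12, neg_one_mul] at h
    exact add_self_eq_zero.mp (eq_neg_iff_add_eq_zero.mp h)
  -- the comparison function on the right half-plane
  set g := hL.continuation with hg
  set G : ℂ → ℂ := fun s ↦ (B : ℂ) ^ s *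
    (∏ w : InfinitePlace K, Gammaℂ (s + (κ w : ℂ) + 1 / 2)) * g (s - 1 / 2) with hG
  set U : Set ℂ := {s | 0 < s.re} with hU
  have hUo : IsOpen U := isOpen_lt continuous_const Complex.continuous_re
  have hUc : IsPreconnected U := (convex_halfSpace_re_gt (0 : ℝ)).isPreconnected
  have hΛU : AnalyticOnNhd ℂ Λ U := hΛ.differentiableOn.analyticOnNhd hUo
  have hGU : AnalyticOnNhd ℂ G U := by
    refine DifferentiableOn.analyticOnNhd (fun s hs ↦ ?_) hUo
    have hs : 0 < s.re := hs
    refine DifferentiableAt.differentiableWithinAt ?_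
    refine ((differentiableAt_id.const_cpow (Or.inl hB0)).mul ?_).mul ?_
    · refine DifferentiableAt.fun_finsetProd (𝕜 := ℂ) (𝔸' := ℂ) (u := Finset.univ)
        (f := fun w s ↦ Gammaℂ (s + (κ w : ℂ) + 1 / 2)) fun w _ ↦ ?_
      refine (Complex.differentiableAt_Gammaℂ_of_re_pos ?_).comp s
        ((differentiableAt_id.add_const _).add_const _)
      rw [re_add_nat_add_half]; positivity
    · exact hL.differentiable_continuation.differentiableAt.comp s (differentiableAt_id.sub_const _)
  have hev : Λ =ᶠ[𝓝 (2 : ℂ)] G := by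
    have hVo : IsOpen {s : ℂ | 3 / 2 < s.re} := isOpen_lt continuous_const Complex.continuous_re
    have h2 : (2 : ℂ) ∈ {s : ℂ | 3 / 2 < s.re} := by
      show (3 / 2 : ℝ) < (2 : ℂ).re
      norm_num
    filter_upwards [hVo.mem_nhds h2] with s hs
    have hs : 3 / 2 < s.re := hs
    have hs1 : 1 < s.re := by linarith
    have hs2 : 1 < (s - 1 / 2).re := by rw [re_sub_half]; linarith
    rw [hG, hagree s hs1, hg]
    beta_reduce
    rw [hL.continuation_eq hs2]
  have h2U : (2 : ℂ) ∈ U := by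
    show (0 : ℝ) < (2 : ℂ).re
    norm_num
  have hEq := hΛU.eqOn_of_preconnected_of_eventuallyEq hGU hUc h2U hev
  have h12U : ((1 : ℂ) / 2) ∈ U := by
    show (0 : ℝ) < ((1 : ℂ) / 2).re
    have : ((1 : ℂ) / 2) = ((1 / 2 : ℝ) : ℂ) := by push_cast; ring
    rw [this, ofReal_re]; norm_num
  have hval := hEq h12U
  rw [hhalf, hG] at hval
  simp only [sub_self] at hval
  have hE : (B : ℂ) ^ ((1 : ℂ) / 2) ≠ 0 := fun h ↦ hB0 ((cpow_eq_zero_iff _ _).mp h).1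
  have hP : ∏ w : InfinitePlace K, Gammaℂ ((1 : ℂ) / 2 + (κ w : ℂ) + 1 / 2) ≠ 0 := by
    refine Finset.prod_ne_zero_iff.mpr fun w _ ↦ Complex.Gammaℂ_ne_zero_of_re_pos ?_
    rw [re_add_nat_add_half]
    have : ((1 : ℂ) / 2).re = 1 / 2 := by
      have h' : ((1 : ℂ) / 2) = ((1 / 2 : ℝ) : ℂ) := by push_cast; ring
      rw [h', ofReal_re]
    rw [this]; positivity
  exact (mul_eq_zero.mp hval.symm).resolve_left (mul_ne_zero hE hP)

/-- Hence every normalised value built on `L(0, χ)` vanishes when `W(χ*) = −1`: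
`L^{alg,𝔩}(0, χ; Ω) = 0` at every continuation, for every period vector and every `k, κ′, 𝔏`.
[cite: Hsieh2012, p. 2 (necessity of (R)) and Remark 6.9 (3) (p. 24)] -/
theorem IsSelfDualRootNumber.algebraicLValue_eq_zero [IsCMField K] {κ : InfinitePlace K → ℕ}
    {χ : HeckeCharacter K} (h : IsSelfDualRootNumber κ χ (-1))
    (hL : LFunction.HasEntireContinuation (heckeLFunction χ)) (k : ℕ) (κ' : InfinitePlace K → ℕ)
    (Ω : InfinitePlace K → ℂ) (𝔏 : HeightOneSpectrum (𝓞 K)) :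
    algebraicLValue k κ' Ω 𝔏 χ (hL.continuation 0) = 0 := by
  rw [h.continuation_zero_eq_zero hL, algebraicLValue, mul_zero, mul_zero]

variable [IsCMField K] {p : ℕ} [Fact p.Prime]

/-- **(R) is necessary for (NV)** — kernel-checked form of p. 2 ("the assumptions (L) and (R) are
necessary for the (NV) property. The assumption (R) is due to the functional equation"): if every
twist `χν`, `ν ∈ X⁻_𝔩`, has root number `−1` in the typed sense (for `𝔩` split in `K` the root
number is CONSTANT on `χ·X⁻_𝔩`: Lemma 6.6 (2), He 2025 Rem. 1.3 — a hypothesis here, not proved),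
and `X⁻_𝔩` is infinite (it is: `Γ⁻ ↠ ℤ_ℓ` — not asserted), then (NV) fails for `(χ, 𝔩)`: every
`ν` lies in the bad set (continuation from the (R)-data, value `0 ∈ 𝔪`).
[cite: Hsieh2012, p. 2 (necessity of (R)), Lemma 6.6 (2) (p. 22), Remark 6.9 (3) (p. 24)] -/
theorem not_NV_of_forall_isSelfDualRootNumber_neg_one {ι : PadicAlgCl p ≃+* ℂ} {ℓ : ℕ}
    {𝔏 : HeightOneSpectrum (𝓞 K)} {χ : HeckeCharacter K} {k : ℕ} {κ κ' : InfinitePlace K → ℕ}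
    (hX : (lPowerAnticyclotomicFamily (K := K) ℓ 𝔏).Infinite)
    (hW : ∀ ν ∈ lPowerAnticyclotomicFamily ℓ 𝔏, IsSelfDualRootNumber κ (χ * ν) (-1)) :
    ¬ NV ι ℓ 𝔏 χ k κ' := by
  rintro ⟨Ω, -, -, hfin⟩
  refine (hX.mono fun ν hν ↦ ?_) hfin
  refine ⟨hν, (hW ν hν).hasEntireContinuation, ?_⟩
  rw [(hW ν hν).algebraicLValue_eq_zero, map_zero, norm_zero]
  exact zero_lt_one

/-- The same for He's conclusion: if every `χν`, `ν ∈ Γ̂`, has root number `−1`, then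
`HeWei2025.NVInfinite ι ℓ 𝔏 χ k κ′` fails — its good set (all continuation values units) is EMPTY,
since each `ν ∈ Γ̂` has a continuation (from the (R)-data) with value `0`. This is He's Remark 1.3
"`μ_p(𝒳⁻) = +∞`" (the `W = −1` half of a self-dual family carries only zero values), and the
reason the typed facts assume (R) `W = +1`. Unconditional (no infinitude hypothesis).
[cite: HeWei2025MathAnn, Remark 1.3] [cite: Hsieh2012, p. 2 (necessity of (R))] -/
theorem not_NVInfinite_of_forall_isSelfDualRootNumber_neg_one {ι : PadicAlgCl p ≃+* ℂ} {ℓ : ℕ}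
    {𝔏 : HeightOneSpectrum (𝓞 K)} {χ : HeckeCharacter K} {k : ℕ} {κ κ' : InfinitePlace K → ℕ}
    (hW : ∀ ν ∈ HeWei2025.lPowerAnticyclotomicFreeFamily ℓ 𝔏,
      IsSelfDualRootNumber κ (χ * ν) (-1)) :
    ¬ HeWei2025.NVInfinite ι ℓ 𝔏 χ k κ' := by
  rintro ⟨Ω, -, -, hinf⟩
  refine hinf (Set.finite_empty.subset ?_)
  rintro ν ⟨hν, hgood⟩
  have h := hgood (hW ν hν).hasEntireContinuation
  rw [(hW ν hν).algebraicLValue_eq_zero, map_zero, norm_zero] at h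
  exact zero_ne_one h

end RootNumber

end Literature.NumberTheory.EllipticCurves.Hsieh2012

end
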